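import Summits.NavierStokesRegularity.NavierStokesRegularity.Theorems.EfficiencyFloorNearSaturationNearMaximiserSeqCoreIdentification
import HarnessLib

/-!
# Route `EfficiencyFloor`, crux `NearSaturationNearMaximiser` (stmt-NavierStokesRegularity-25482) on the
# `ProductionEfficiencyDecay` ladder (stmt-22866): BY NAME — stmt-25482 from RELLICH–KONDRACHOV + REGULARITY OF THE LIMIT PROFILE

Def-free helper file, fourteenth of the group. The hypothesis (P_w⁶) of `nearSaturationNearMaximiser_of_gradientIdentification`
(`…SeqCoreIdentification`) is split into two named pieces:

* (R) **local Rellich–Kondrachov on `ℝ³`** — every sequence of `C¹` fields `g_k` with `‖g_k‖₂² ≤ 1`, `‖Dg_k‖₂² ≤ 1` has a subsequence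
  converging in `L²(B(0,R))` for every `R` to one `L²` field `Ω` (a THEOREM of the literature, Rellich–Kondrachov / Evans *PDE* §5.7 Thm. 1
  with a diagonal argument over `R ∈ ℕ`; NOT in Mathlib — kept here as an explicit hypothesis, not as a Literature fact);
* (I) **identification / regularity of the limit profile** — for the sharp constant, along a centred normalised maximising sequence and a
  subsequence `φ₀` on which `∂ⱼ v_{φ₀k} ⇀ M_j` weakly in `L²` and `curl v_{φ₀k} → Ω` in `L²_loc`, there is an ADMISSIBLE `w` (smooth,
  divergence-free, `D⁰,D¹,D² ∈ L²`) with `∂ⱼ w = M_j` and `curl w = Ω` almost everywhere. THIS is the open analytic content that remains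
  of stmt-25482 in this line: existence, regularity and decay of the Lu–Doering extremising profile.

* `nearSaturationNearMaximiser_of_rellich_of_identification` — BY NAME: stmt-25482 ⟸ (R) ∧ (I).

HONEST FRAMING: neither (R) (in Lean) nor (I) is proved here; stmt-25482, `LerayFloorGap`, `ProductionEfficiencyDecay` (stmt-22866) and
Navier–Stokes regularity stay OPEN; no summit statement is proved. [folklore]
-/

-- the problem directory repeats the summit name (`NavierStokesRegularity/NavierStokesRegularity`)
set_option linter.dupNamespace false

noncomputable section

namespace Summit.NavierStokesRegularity.NavierStokesRegularity.Theorems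

namespace NearSaturationNearMaximiser

namespace SeqCore

open Set MeasureTheory Filter Topology Function
open scoped InnerProductSpace ENNReal NNReal
open Literature.Analysis.FluidPDE
open Magsanop2026Enstrophy (slice_integrable)

/-- **`NearSaturationNearMaximiser` (stmt-25482) from local Rellich–Kondrachov and the regularity of the limit profile, BY NAME.**
(R): local `L²` compactness of `H¹(ℝ³)`-bounded sequences of `C¹` fields (Rellich–Kondrachov with a diagonal argument; a hypothesis here).
(I): for the sharp constant, the weak-limit velocity gradient `(M_j)` and the local strong limit `Ω` of the vorticities along a
subsequence of a centred normalised maximising sequence are the gradient and the curl of one ADMISSIBLE field `w`. Given (R) and (I),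
the extraction (`…SeqCoreWeakLimit`, `…SeqCoreIdentification`) and the whole concentration-compactness chain close stmt-25482.
[cite: Evans2010, §5.7 Thm. 1] -/
theorem nearSaturationNearMaximiser_of_rellich_of_identification
    (HR : ∀ g : ℕ → EuclideanSpace ℝ (Fin 3) → EuclideanSpace ℝ (Fin 3), (∀ k, ContDiff ℝ 1 (g k)) →
      (∀ k, Integrable (fun x => ‖g k x‖ ^ 2)) → (∀ k, Integrable (fun x => ‖fderiv ℝ (g k) x‖ ^ 2)) →
      (∀ k, ∫ x, ‖g k x‖ ^ 2 ≤ 1) → (∀ k, ∫ x, ‖fderiv ℝ (g k) x‖ ^ 2 ≤ 1) →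
      ∃ Ω : EuclideanSpace ℝ (Fin 3) → EuclideanSpace ℝ (Fin 3), MemLp Ω 2 volume ∧ ∃ φ : ℕ → ℕ, StrictMono φ ∧
        ∀ R : ℝ, 0 < R → Tendsto (fun k => ∫ x in Metric.ball (0 : EuclideanSpace ℝ (Fin 3)) R, ‖g (φ k) x - Ω x‖ ^ 2) atTop (𝓝 0))
    (HI : ∀ c : ℝ, (0 < c ∧ (∀ v : EuclideanSpace ℝ (Fin 3) → EuclideanSpace ℝ (Fin 3), (ContDiff ℝ (⊤ : ℕ∞) v ∧
      Literature.Analysis.FluidPDE.VectorCalculus.IsDivFree v ∧ (∫⁻ x, ‖iteratedFDeriv ℝ 0 v x‖ₑ ^ 2 < ⊤) ∧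
      (∫⁻ x, ‖iteratedFDeriv ℝ 1 v x‖ₑ ^ 2 < ⊤) ∧ (∫⁻ x, ‖iteratedFDeriv ℝ 2 v x‖ₑ ^ 2 < ⊤)) → (∫ x,
      ⟪Literature.Analysis.FluidPDE.curl v x, fderiv ℝ v x (Literature.Analysis.FluidPDE.curl v x)⟫_ℝ) ≤ c *
      (∫ x, ‖Literature.Analysis.FluidPDE.curl v x‖ ^ 2) ^ (3 / 4 : ℝ) * (∫ x,
      Literature.Analysis.FluidPDE.frobeniusNormSq (fderiv ℝ (Literature.Analysis.FluidPDE.curl v) x)) ^ (3 / 4 : ℝ)) ∧ ∀ c' : ℝ, (∀ w : EuclideanSpace ℝ (Fin 3) → EuclideanSpace ℝ (Fin 3), (ContDiff ℝ (⊤ : ℕ∞) w ∧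
      Literature.Analysis.FluidPDE.VectorCalculus.IsDivFree w ∧ (∫⁻ x, ‖iteratedFDeriv ℝ 0 w x‖ₑ ^ 2 < ⊤) ∧
      (∫⁻ x, ‖iteratedFDeriv ℝ 1 w x‖ₑ ^ 2 < ⊤) ∧ (∫⁻ x, ‖iteratedFDeriv ℝ 2 w x‖ₑ ^ 2 < ⊤)) → (∫ x,
      ⟪Literature.Analysis.FluidPDE.curl w x, fderiv ℝ w x (Literature.Analysis.FluidPDE.curl w x)⟫_ℝ) ≤ c' *
      (∫ x, ‖Literature.Analysis.FluidPDE.curl w x‖ ^ 2) ^ (3 / 4 : ℝ) * (∫ x,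
      Literature.Analysis.FluidPDE.frobeniusNormSq (fderiv ℝ (Literature.Analysis.FluidPDE.curl w) x)) ^ (3 / 4 : ℝ)) → c ≤ c') →
      ∀ K δ : ℝ, 0 < K → 0 < δ → ∀ v : ℕ → EuclideanSpace ℝ (Fin 3) → EuclideanSpace ℝ (Fin 3),
      (∀ n, (ContDiff ℝ (⊤ : ℕ∞) (v n) ∧
      Literature.Analysis.FluidPDE.VectorCalculus.IsDivFree (v n) ∧ (∫⁻ x, ‖iteratedFDeriv ℝ 0 (v n) x‖ₑ ^ 2 < ⊤) ∧
      (∫⁻ x, ‖iteratedFDeriv ℝ 1 (v n) x‖ₑ ^ 2 < ⊤) ∧ (∫⁻ x, ‖iteratedFDeriv ℝ 2 (v n) x‖ₑ ^ 2 < ⊤))) →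
      (∀ n, (∫ x, ‖Literature.Analysis.FluidPDE.curl (v n) x‖ ^ 2) = 1) →
      (∀ n, (∫ x, Literature.Analysis.FluidPDE.frobeniusNormSq (fderiv ℝ (Literature.Analysis.FluidPDE.curl (v n)) x)) = 1) →
      Tendsto (fun n => ∫ x, ⟪Literature.Analysis.FluidPDE.curl (v n) x, fderiv ℝ (v n) x
        (Literature.Analysis.FluidPDE.curl (v n) x)⟫_ℝ) atTop (𝓝 c) →
      (∀ᶠ n in atTop, δ ≤ ∫ x in Metric.ball (0 : EuclideanSpace ℝ (Fin 3)) K, ‖Literature.Analysis.FluidPDE.curl (v n) x‖ ^ 2) →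
      ∀ (φ₀ : ℕ → ℕ) (M : Fin 3 → EuclideanSpace ℝ (Fin 3) → EuclideanSpace ℝ (Fin 3))
        (Ω : EuclideanSpace ℝ (Fin 3) → EuclideanSpace ℝ (Fin 3)), StrictMono φ₀ →
      (∀ j, MemLp (M j) 2 volume) →
      (∀ (j : Fin 3) (ψ : EuclideanSpace ℝ (Fin 3) → EuclideanSpace ℝ (Fin 3)), MemLp ψ 2 volume →
        Tendsto (fun k => ∫ x, ⟪fderiv ℝ (v (φ₀ k)) x (EuclideanSpace.basisFun (Fin 3) ℝ j), ψ x⟫_ℝ) atTop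
          (𝓝 (∫ x, ⟪M j x, ψ x⟫_ℝ))) →
      MemLp Ω 2 volume →
      (∀ R : ℝ, 0 < R → Tendsto (fun k => ∫ x in Metric.ball (0 : EuclideanSpace ℝ (Fin 3)) R,
          ‖Literature.Analysis.FluidPDE.curl (v (φ₀ k)) x - Ω x‖ ^ 2) atTop (𝓝 0)) →
      ∃ w : EuclideanSpace ℝ (Fin 3) → EuclideanSpace ℝ (Fin 3), (ContDiff ℝ (⊤ : ℕ∞) w ∧
      Literature.Analysis.FluidPDE.VectorCalculus.IsDivFree w ∧ (∫⁻ x, ‖iteratedFDeriv ℝ 0 w x‖ₑ ^ 2 < ⊤) ∧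
      (∫⁻ x, ‖iteratedFDeriv ℝ 1 w x‖ₑ ^ 2 < ⊤) ∧ (∫⁻ x, ‖iteratedFDeriv ℝ 2 w x‖ₑ ^ 2 < ⊤)) ∧
        (∀ j : Fin 3, (fun x => fderiv ℝ w x (EuclideanSpace.basisFun (Fin 3) ℝ j)) =ᵐ[volume] M j) ∧
        Literature.Analysis.FluidPDE.curl w =ᵐ[volume] Ω) :
    Summit.NavierStokesRegularity.NavierStokesRegularity.Theses.EfficiencyFloor.NearSaturationNearMaximiser := by
  refine nearSaturationNearMaximiser_of_gradientIdentification fun c hsharp K δ hK hδ v hAdm hZ1 hP1 hS hcen φ₀ M hφ₀ hM hconv => ?_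
  -- Rellich along `curl v_{φ₀ k}`
  have hg1 : ∀ k, ContDiff ℝ 1 (curl (v (φ₀ k))) := fun k => contDiff_curl (n := 1) ((hAdm (φ₀ k)).1.of_le (by norm_cast))
  have hI : ∀ k, Integrable (fun x => ‖curl (v (φ₀ k)) x‖ ^ 2) ∧ Integrable (fun x => ‖fderiv ℝ (curl (v (φ₀ k))) x‖ ^ 2) ∧
      ∫ x, ‖fderiv ℝ (curl (v (φ₀ k))) x‖ ^ 2 ≤ 1 := by
    intro k
    have h3 : ContDiff ℝ 3 (v (φ₀ k)) := (hAdm (φ₀ k)).1.of_le (by norm_cast)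
    obtain ⟨I2, ID, IF, -⟩ := slice_integrable h3 (hAdm (φ₀ k)).2.2.2.1 (hAdm (φ₀ k)).2.2.2.2
    exact ⟨I2, ID, (integral_mono ID IF fun x => norm_sq_le_frobeniusNormSq _).trans (hP1 (φ₀ k)).le⟩
  obtain ⟨Ω, hΩ, φ₁, hφ₁, hlocΩ⟩ := HR (fun k => curl (v (φ₀ k))) hg1 (fun k => (hI k).1) (fun k => (hI k).2.1)
    (fun k => (hZ1 (φ₀ k)).le) (fun k => (hI k).2.2)
  -- identification along `φ₀ ∘ φ₁`
  have hconv' : ∀ (j : Fin 3) (ψ : EuclideanSpace ℝ (Fin 3) → EuclideanSpace ℝ (Fin 3)), MemLp ψ 2 volume →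
      Tendsto (fun k => ∫ x, ⟪fderiv ℝ (v ((φ₀ ∘ φ₁) k)) x (EuclideanSpace.basisFun (Fin 3) ℝ j), ψ x⟫_ℝ) atTop
        (𝓝 (∫ x, ⟪M j x, ψ x⟫_ℝ)) := fun j ψ hψ => (hconv j ψ hψ).comp hφ₁.tendsto_atTop
  obtain ⟨w, hw, hMw, hΩw⟩ := HI c hsharp K δ hK hδ v hAdm hZ1 hP1 hS hcen (φ₀ ∘ φ₁) M Ω (hφ₀.comp hφ₁) hM hconv' hΩ hlocΩ
  refine ⟨w, hw, hMw, φ₁, hφ₁, fun R hR => ?_⟩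
  -- `curl (v − w) = curl v − Ω` a.e.
  refine (hlocΩ R hR).congr' (Eventually.of_forall fun k => ?_)
  refine integral_congr_ae (ae_restrict_of_ae (hΩw.mono fun x hx => ?_))
  have hc : curl (v (φ₀ (φ₁ k)) - w) x = curl (v (φ₀ (φ₁ k))) x - curl w x :=
    congrFun (curl_sub_eq ((hAdm _).1.differentiable (by simp)) (hw.1.differentiable (by simp))) x
  show ‖curl (v (φ₀ (φ₁ k))) x - Ω x‖ ^ 2 = ‖curl (v ((φ₀ ∘ φ₁) k) - w) x‖ ^ 2
  rw [Function.comp_apply, hc, hx]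

end SeqCore

end NearSaturationNearMaximiser

end Summit.NavierStokesRegularity.NavierStokesRegularity.Theorems

end
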